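import Mathlib
import Summits.AtomisticToContinuum.Crystallization.Theorems.DisclinationRationFiveFoldRationDefs
import Summits.AtomisticToContinuum.Crystallization.Theorems.DisclinationRationFiveFoldRationStubShellMutual
import Summits.AtomisticToContinuum.Crystallization.Theorems.DisclinationRationFiveFoldRationStubLinks
import Summits.AtomisticToContinuum.Crystallization.Theorems.DisclinationRationFiveFoldRationStubDichotomy
import Summits.AtomisticToContinuum.Crystallization.Theorems.DisclinationRationFiveFoldRationStubCapping
import Summits.AtomisticToContinuum.Crystallization.Theorems.DisclinationRationFiveFoldRationStubPoleLemma
import Summits.AtomisticToContinuum.Crystallization.Theorems.DisclinationRationFiveFoldRationStubChains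

/-!
# Crux `DisclinationRation.FiveFoldRation` (stmt-AtomisticToContinuum-15799), line `Sketch` —
# the landed front end, assembled in the named vocabulary

Two glue theorems over `Theorems/DisclinationRationFiveFoldRationDefs.lean`:

* `frontEnd_of_isAdmissible` — every admissible `S` (separated, relatively dense, everywhere alphabet-good)
  satisfies the per-`S` FRONT END of line `Sketch`: shell symmetry (`stub_dr5_shellMutual`), links are pattern
  adjacency (`stub_dr5_links`), square link faces are capped (`stub_dr5_capping`, fed by `stub_dr5_dichotomy`),
  and the axis sites form bi-infinite pole-to-pole columns (`stub_dr5_chains ∘ stub_dr5_poleLemma`).  All six stubs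
  are landed; this file only instantiates them (the named predicates unfold definitionally to the stubs'
  `let`-abbreviated statements).
* `layerInequality_of_linearAxisCensusAt` — the natural output of a comparison-geometry engine, a LINEAR axis
  census about every centre (`LinearAxisCensusAt S`), implies the conclusion `LayerInequality S` of the open core
  stub (drop the non-negative bracket; `C₁ := C/8`, `W₀ := 1/16`), given finiteness of `S` in balls
  (`stub_dr5_cubic`).  So the open core of the line may equivalently be attacked as
  `IsAdmissible δ S → FrontEnd S → LinearAxisCensusAt S`.
-/

noncomputable section

namespace Summit.AtomisticToContinuum.Crystallization.Theorems.FiveFoldRation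

open Summit.AtomisticToContinuum.Crystallization.Theorems

/-- **The front end holds for admissible sets**: shell symmetry, links, capping and columns, from the six landed
stubs of line `Sketch`. -/
theorem frontEnd_of_isAdmissible {δ : ℝ} (hδ : 0 < δ) {S : Set E3} (hS : IsAdmissible δ S) : FrontEnd S := by
  obtain ⟨hsep, hdense, hgood⟩ := hS
  have h2 := stub_dr5_shellMutual
  have h3 := stub_dr5_poleLemma
  have h4 := stub_dr5_chains
  have h5 := stub_dr5_links
  have h6 := stub_dr5_dichotomy
  have h7 := stub_dr5_capping
  simp only [] at h2 h3 h4 h5 h6 h7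
  refine ⟨?_, ?_, ?_, ?_⟩
  · exact h2 δ hδ S hsep hdense hgood
  · exact h5 h2 δ hδ S hsep hdense hgood
  · intro y hy t₁ t₂ t₃ t₄ hsq
    obtain ⟨g1, g2, g3, g4, a12, a23, a34, a41, d13, d24, n13, n24⟩ := hsq
    exact h7 h2 (h5 h2) h6 δ hδ S hsep hdense hgood y hy t₁ g1 t₂ g2 t₃ g3 t₄ g4 a12 a23 a34 a41 d13 d24 n13 n24
  · obtain ⟨Γ, c1, c2, c3⟩ := h4 (h3 h2) δ hδ S hsep hdense hgood
    exact ⟨Γ, fun y hy => c1 y hy.1 hy.2, fun γ hγ n => c2 γ hγ n, fun γ hγ n => c3 γ hγ n⟩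

/-- **A linear axis census implies the layer inequality** (bracket dropped): if `S` meets every ball in a finite
set and `#(axisSites S ∩ B̄_L(c)) ≤ C (L + 1)` for all `c` and `L ≥ 0`, then with `C₁ := max C 0 / 8` and
`W₀ := 1/16` one has `Nax(r − 6W) ≤ C₁ r³/W + (Nax(r − 4W) − Nax(r − 8W))/3` for all `W ≥ W₀`, `r ≥ 16 W`
(the bracket is `≥ 0` by monotonicity, and `C (r + 1) ≤ 2 C r ≤ (C/8)·16 r² ≤ (C/8) r³/W`). -/
theorem layerInequality_of_linearAxisCensusAt {S : Set E3}
    (hfin : ∀ c : E3, ∀ r : ℝ, (S ∩ Metric.closedBall c r).Finite) (h : LinearAxisCensusAt S) :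
    LayerInequality S := by
  obtain ⟨C, hC⟩ := h
  have hAxS : axisSites S ⊆ S := fun y hy => hy.1
  have hfinA : ∀ c : E3, ∀ r : ℝ, (axisSites S ∩ Metric.closedBall c r).Finite := fun c r =>
    (hfin c r).subset (Set.inter_subset_inter_left _ hAxS)
  have hmono : ∀ c : E3, ∀ r r' : ℝ, r ≤ r' → axisCount S c r ≤ axisCount S c r' := by
    intro c r r' hrr'
    simp only [axisCount]
    exact_mod_cast Set.ncard_le_ncard
      (Set.inter_subset_inter_right _ (Metric.closedBall_subset_closedBall hrr')) (hfinA c r')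
  have hnn : ∀ c : E3, ∀ r : ℝ, 0 ≤ axisCount S c r := fun c r => by
    simp only [axisCount]; exact Nat.cast_nonneg _
  refine ⟨max C 0 / 8, 1 / 16, fun c W r hW hr => ?_⟩
  have hW0 : 0 < W := lt_of_lt_of_le (by norm_num) hW
  have hr1 : 1 ≤ r := by linarith
  have hr0 : 0 ≤ r := by linarith
  -- the bracket is non-negative
  have hbr : 0 ≤ axisCount S c (r - 4 * W) - axisCount S c (r - 8 * W) := by
    have := hmono c (r - 8 * W) (r - 4 * W) (by linarith)
    linarith
  -- the census at radius r - 6W ≤ the census at radius r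
  have h1 : axisCount S c (r - 6 * W) ≤ max C 0 * (r + 1) := by
    calc axisCount S c (r - 6 * W) ≤ axisCount S c r := hmono c _ _ (by linarith)
      _ ≤ C * (r + 1) := hC c r hr0
      _ ≤ max C 0 * (r + 1) := by
          apply mul_le_mul_of_nonneg_right (le_max_left _ _); linarith
  have hC0 : 0 ≤ max C 0 := le_max_right _ _
  -- max C 0 * (r + 1) ≤ (max C 0 / 8) * r ^ 3 / W
  have h2 : max C 0 * (r + 1) ≤ max C 0 / 8 * r ^ 3 / W := by
    rw [le_div_iff₀ hW0]
    -- max C 0 * (r + 1) * W ≤ max C 0 / 8 * r ^ 3, using W ≤ r / 16 and r + 1 ≤ 2 r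
    have hWr : W ≤ r / 16 := by linarith
    have : max C 0 * (r + 1) * W ≤ max C 0 * (2 * r) * (r / 16) := by
      apply mul_le_mul _ hWr hW0.le (by positivity)
      exact mul_le_mul_of_nonneg_left (by linarith) hC0
    calc max C 0 * (r + 1) * W ≤ max C 0 * (2 * r) * (r / 16) := this
      _ = max C 0 / 8 * (r * r) := by ring
      _ ≤ max C 0 / 8 * r ^ 3 := by
          apply mul_le_mul_of_nonneg_left _ (by positivity)
          nlinarith
  linarith

end Summit.AtomisticToContinuum.Crystallization.Theorems.FiveFoldRation

end
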